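import Mathlib
import HarnessLib
import Literature.Computability.Complexity.CNF
import Literature.Computability.Complexity.PNPWave0
import Literature.Computability.Complexity.BoolEncodings
import Summits.PneNP.PneNP.Theses.OverlapGapAlgebra
import Summits.PneNP.PneNP.Theorems.OverlapGapAlgebraSearchHardWindowCore

/-!
# Sketch — crux idea `unsat-decoy-hybrid` (crux stmt-PneNP-2460 `SearchHardWindow`, ideator 5, round 2)

First lemma of the line: the hardness conjunct `H(k, α)` of `SearchHardWindow` follows from the
existence of PSEUDORANDOM UNSAT DECOYS at `(k, α)` — a sequence of probability measures `Q n` on the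
instance space of `F_k(n, ⌊αn⌋)` that (i) put vanishing mass on satisfiable instances and (ii) are
indistinguishable from the uniform instance by every polynomial-time Boolean test (advantage → 0) —
plus ONE plumbing fact (`SolverTestClosure`: "the output of the poly-time word function `f`
satisfies the coded formula" is a poly-time predicate of the code).  The only use made of an
arbitrary poly-time solver `f` is that `Φ ↦ [f solves Φ]` is a poly-time TEST (hybrid argument); no
class lower bound and no simulation of `f` inside a weak class occur (contrast census (F3)).
`searchHardWindow_of_decoy` then feeds the tree's `searchHardWindow_of_hard_below_rho`.
-/

namespace Summit.PneNP.PneNP.Cruxes.SearchHardWindow.DecoySketch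

set_option linter.dupNamespace false

open Filter Finset Literature.Computability.Complexity
open Summit.PneNP.PneNP.Theses.OverlapGapAlgebra
open scoped Classical

noncomputable section

/-- Instance space of `F_k(n, m)` in the route's with-replacement literal-array model. -/
abbrev Inst (k n m : ℕ) := Fin m → Fin k → Fin n × Bool

/-- Satisfiability of a literal array (literal `(v,b)` true under `σ` iff `σ v = b`). -/
def Satisfiable {k n m : ℕ} (Φ : Inst k n m) : Prop :=
  ∃ σ : Fin n → Bool, ∀ i, ∃ j, σ (Φ i j).1 = (Φ i j).2

/-- The route's input encoding of an instance (`encodingCNF` of its clause list). -/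
def enc {k n m : ℕ} (Φ : Inst k n m) : List Bool :=
  encodingCNF.encode (List.ofFn fun a => List.ofFn fun b => (((Φ a b).1 : ℕ), (Φ a b).2))

/-- The route's success predicate: the word `f (enc Φ)`, read as a table, satisfies `Φ`. -/
def Solves {k n m : ℕ} (f : List Bool → List Bool) (Φ : Inst k n m) : Prop :=
  ∀ i, ∃ j, (f (enc Φ)).getD (Φ i j).1 false = (Φ i j).2

/-- Acceptance probability of a Boolean word test under the UNIFORM instance `F_k(n, m)`. -/
def accUnif (k n m : ℕ) (T : List Bool → Bool) : ℝ :=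
  ((univ.filter fun Φ : Inst k n m => T (enc Φ) = true).card : ℝ) / Fintype.card (Inst k n m)

/-- Acceptance probability of a Boolean word test under a decoy measure `Q`. -/
def accQ {k n m : ℕ} (Q : PMF (Inst k n m)) (T : List Bool → Bool) : ℝ :=
  ∑ Φ : Inst k n m, if T (enc Φ) = true then (Q Φ).toReal else 0

/-- Mass a decoy measure puts on SATISFIABLE instances. -/
def satMass {k n m : ℕ} (Q : PMF (Inst k n m)) : ℝ :=
  ∑ Φ : Inst k n m, if Satisfiable Φ then (Q Φ).toReal else 0

/-- The hardness conjunct of the crux at `(k, α)` (verbatim the `hhard` hypothesis of the tree's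
`searchHardWindow_of_hard_below_rho`, i.e. the second conjunct of `SearchHardWindow`). -/
def HardAt (k : ℕ) (α : ℝ) : Prop :=
  ∀ f : List Bool → List Bool, IsPolyTime f → ∀ ε : ℝ, 0 < ε →
    ∀ᶠ n : ℕ in atTop, ∀ m : ℕ, m = ⌊α * n⌋₊ →
      ((Finset.univ.filter fun Φ : Fin m → Fin k → Fin n × Bool => ∀ i, ∃ j,
        (f (encodingCNF.encode (List.ofFn fun a => List.ofFn fun b =>
          (((Φ a b).1 : ℕ), (Φ a b).2)))).getD (Φ i j).1 false = (Φ i j).2).card : ℝ) /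
        Fintype.card (Fin m → Fin k → Fin n × Bool) ≤ ε

/-- **PSEUDORANDOM UNSAT DECOYS at `(k, α)`** (the line's kernel object; no samplability is needed
for the implication below — samplability / a trapdoor construction is what a proof of this
hypothesis would supply): measures `Q n` on the instances of `F_k(n, ⌊αn⌋)` with
(i) `Q n`-mass of satisfiable instances `→ 0`, and (ii) every polynomial-time Boolean test has
acceptance probability under `Q n` within `o(1)` of its acceptance probability under the uniform
instance. -/
def DecoyAt (k : ℕ) (α : ℝ) : Prop :=
  ∃ Q : (n : ℕ) → PMF (Inst k n ⌊α * n⌋₊),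
    (∀ δ : ℝ, 0 < δ → ∀ᶠ n : ℕ in atTop, satMass (Q n) ≤ δ) ∧
    ∀ T : List Bool → Bool, IsPolyTimePred T → ∀ δ : ℝ, 0 < δ →
      ∀ᶠ n : ℕ in atTop, |accUnif k n ⌊α * n⌋₊ T - accQ (Q n) T| ≤ δ

/-- **Plumbing** (machine fact, M-sized, of the `EvalRelationInP` kind already proved in the tree as a
RELATION): for every poly-time word function `f` the predicate "the table `f x` satisfies the clause
list coded by `x`" is a poly-time PREDICATE of `x` (compose `f` with a CNF evaluator reading the
binary variable indices of `encodingCNF`; behaviour off codewords is free). Stated only on the codes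
`enc Φ` that the line needs. -/
def SolverTestClosure : Prop :=
  ∀ f : List Bool → List Bool, IsPolyTime f →
    ∃ T : List Bool → Bool, IsPolyTimePred T ∧
      ∀ (k n m : ℕ) (Φ : Inst k n m), (T (enc Φ) = true ↔ Solves f Φ)

/-- A test that accepts only solved instances accepts at most the satisfiable mass under `Q`. -/
theorem accQ_le_satMass {k n m : ℕ} (Q : PMF (Inst k n m)) (T : List Bool → Bool)
    (f : List Bool → List Bool) (hT : ∀ Φ : Inst k n m, T (enc Φ) = true ↔ Solves f Φ) :
    accQ Q T ≤ satMass Q := by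
  unfold accQ satMass
  refine Finset.sum_le_sum fun Φ _ => ?_
  by_cases h : T (enc Φ) = true
  · have hsat : Satisfiable Φ := by
      obtain hsol := (hT Φ).1 h
      exact ⟨fun v => (f (enc Φ)).getD v false, fun i => by
        obtain ⟨j, hj⟩ := hsol i
        exact ⟨j, hj⟩⟩
    simp [h, hsat]
  · have : (0 : ℝ) ≤ (if Satisfiable Φ then (Q Φ).toReal else 0) := by
      split_ifs <;> simp
    simpa [h] using this

/-- The uniform acceptance probability of the solver-test of `f` IS the success ratio of `f`. -/
theorem accUnif_eq_successRatio {k n m : ℕ} (T : List Bool → Bool) (f : List Bool → List Bool)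
    (hT : ∀ Φ : Inst k n m, T (enc Φ) = true ↔ Solves f Φ) :
    accUnif k n m T =
      ((Finset.univ.filter fun Φ : Fin m → Fin k → Fin n × Bool => ∀ i, ∃ j,
        (f (encodingCNF.encode (List.ofFn fun a => List.ofFn fun b =>
          (((Φ a b).1 : ℕ), (Φ a b).2)))).getD (Φ i j).1 false = (Φ i j).2).card : ℝ) /
        Fintype.card (Fin m → Fin k → Fin n × Bool) := by
  unfold accUnif
  have hfilter : (univ.filter fun Φ : Inst k n m => T (enc Φ) = true) =
      (Finset.univ.filter fun Φ : Fin m → Fin k → Fin n × Bool => ∀ i, ∃ j,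
        (f (encodingCNF.encode (List.ofFn fun a => List.ofFn fun b =>
          (((Φ a b).1 : ℕ), (Φ a b).2)))).getD (Φ i j).1 false = (Φ i j).2) := by
    refine Finset.filter_congr fun Φ _ => ?_
    simpa [Solves, enc] using hT Φ
  rw [hfilter]

/-- **FIRST LEMMA (hybrid argument).** Pseudorandom UNSAT decoys at `(k, α)` plus the plumbing fact
give the hardness conjunct `H(k, α)`: a poly-time `f` with success `≥ ε` infinitely often would be a
poly-time test separating `F_k` from the decoys by `ε - o(1)`. -/
theorem hardAt_of_decoy {k : ℕ} {α : ℝ} (hplumb : SolverTestClosure) (hdec : DecoyAt k α) :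
    HardAt k α := by
  intro f hf ε hε
  obtain ⟨T, hTpoly, hT⟩ := hplumb f hf
  obtain ⟨Q, hsat, hind⟩ := hdec
  have h1 := hsat (ε / 2) (half_pos hε)
  have h2 := hind T hTpoly (ε / 2) (half_pos hε)
  filter_upwards [h1, h2] with n hn1 hn2 m hm
  subst hm
  have hT' : ∀ Φ : Inst k n ⌊α * n⌋₊, T (enc Φ) = true ↔ Solves f Φ := fun Φ => hT k n _ Φ
  rw [← accUnif_eq_successRatio T f hT']
  have h3 : accQ (Q n) T ≤ satMass (Q n) := accQ_le_satMass (Q n) T f hT'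
  have h4 : accUnif k n ⌊α * n⌋₊ T ≤ accQ (Q n) T + ε / 2 := by
    have := (abs_sub_le_iff.1 hn2).1
    linarith
  linarith

/-- **Composition with the tree.** For `k ≥ 1024` and a density `r` below the Achlioptas–Peres
radius `ρ_k` (where uniformly positive satisfiability is the tree theorem
`achlioptasPeres2004_uniformlyPos`), decoys at `(k, r)` give the crux `SearchHardWindow`
(via `Summit.PneNP.PneNP.Theorems.searchHardWindow_of_hard_below_rho`). -/
theorem searchHardWindow_of_decoy {k : ℕ} (hk : 1024 ≤ k) {r : ℝ}
    (hr : r < (2 ^ k * Real.log 2 - ((k : ℝ) + 1) * Real.log 2 / 2 - 1) -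
      2 * (15 * (k : ℝ) ^ 2 / 2 ^ k + (((k : ℝ) + 3) / 2 ^ k + 32 * (k : ℝ) ^ 2 * (50 / 81) ^ k +
        32 * (k : ℝ) * (5 / 9) ^ k)))
    (hplumb : SolverTestClosure) (hdec : DecoyAt k r) : SearchHardWindow :=
  Summit.PneNP.PneNP.Theorems.searchHardWindow_of_hard_below_rho hk hr (hardAt_of_decoy hplumb hdec)

/-- The positive-satisfiability conjunct of the crux at `(k, α)` (first conjunct of
`SearchHardWindow`): uniformly positive satisfiability of `F_k(n, ⌊αn⌋)`. -/
def PosSatAt (k : ℕ) (α : ℝ) : Prop :=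
  ∃ ε : ℝ, 0 < ε ∧ ∀ᶠ n : ℕ in atTop, ∀ m : ℕ, m = ⌊α * n⌋₊ →
    ε ≤ ((Finset.univ.filter fun Φ : Fin m → Fin k → Fin n × Bool =>
      ∃ σ : Fin n → Bool, ∀ i, ∃ j, σ (Φ i j).1 = (Φ i j).2).card : ℝ) /
      Fintype.card (Fin m → Fin k → Fin n × Bool)

/-- **Composition, density-free form.** Decoys + plumbing + positive satisfiability at the SAME
`(k, α)` give the crux; this is the form the line uses at the near-threshold density
`r_k ∈ [2^k log 2 - (k+1) log 2/2 + 1, 2^k log 2 - (1 + log 2)/2 - ε_k)`, where `PosSatAt` is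
Coja-Oghlan–Panagiotou 2016 Thm 1.1 (to be vendored as a Literature fact) and `AdvSignUnsat`
holds by the anti-paired signing lemma below. -/
theorem searchHardWindow_of_decoy_posSat {k : ℕ} {α : ℝ} (hpos : PosSatAt k α)
    (hplumb : SolverTestClosure) (hdec : DecoyAt k α) : SearchHardWindow :=
  ⟨k, α, hpos, hardAt_of_decoy hplumb hdec⟩

/-! ## The complexity-free gates the decoy construction must pass first (statements only)

`AdvSignUnsat k α` — Q1, EXISTENCE: the random `k`-uniform hypergraph at density `α` admits, with
probability → 1, a choice of literal signs making the formula unsatisfiable (necessary for any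
sign-carried decoy; trivially true for `α ≥ 2^k log 2` by the first moment over signs — Scheder
2009 Lemma 1 — and the crux needs it at some `α < ρ_k < 2^k log 2`).  Typed over the route's model:
the hypergraph of `Φ` is `fun i j => (Φ i j).1`, a re-signing is any `s : Fin m → Fin k → Bool`. -/
def AdvSignUnsat (k : ℕ) (α : ℝ) : Prop :=
  ∀ δ : ℝ, 0 < δ → ∀ᶠ n : ℕ in atTop, ∀ m : ℕ, m = ⌊α * n⌋₊ →
    (1 - δ) * Fintype.card (Inst k n m) ≤
      ((univ.filter fun Φ : Inst k n m =>
        ∃ s : Fin m → Fin k → Bool, ¬ Satisfiable (fun i j => ((Φ i j).1, s i j))).card : ℝ)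

/-- **Anti-paired signing lemma** (Gate 1, deterministic; provable now — pair up the occurrences of
each variable, give paired occurrences opposite signs with one fair coin per pair; for every
assignment exactly one occurrence per pair is falsified, so the annealed count is
`2^n · Z_{G_M}(-2^{-k})`, the independence polynomial of the pair-adjacency graph of the clauses
(max degree ≤ k, dependent clauses mutually exclusive) at fugacity `-2^{-k}`, inside the
Kotecký–Preiss region; its cluster expansion gives `log Z ≤ -m 2^{-k} - m 2^{-2k-1}(k+1)(1-o(1))`):
for all large `k`, EVERY array of variable indices with `m ≥ (2^k log 2 - (k+1) log 2 / 2 + 1)·n`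
clauses of `k` pairwise distinct variables carries signs making it unsatisfiable.  (Scheder 2009
Lemma 1 is the uncorrelated version at `m/n ≥ 2^k log 2`; Rathi–Aurell–Rasmussen–Skoglund 2010
eq. (temp4) shows the same `(1 - 2^{-k-1})^{-k}` factor for the random REGULAR model.) -/
def AntiPairedUnsat : Prop :=
  ∃ k₀ : ℕ, ∀ k ≥ k₀, ∀ n m : ℕ,
    ((2 : ℝ) ^ k * Real.log 2 - ((k : ℝ) + 1) * Real.log 2 / 2 + 1) * n ≤ m →
      ∀ V : Fin m → Fin k → Fin n, (∀ i, Function.Injective (V i)) →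
        ∃ s : Fin m → Fin k → Bool, ¬ Satisfiable (fun i j => (V i j, s i j) : Inst k n m)

/-- Sanity of the typing (the re-signed instance has the same hypergraph). -/
example {k n m : ℕ} (Φ : Inst k n m) (s : Fin m → Fin k → Bool) (i : Fin m) (j : Fin k) :
    ((fun i j => ((Φ i j).1, s i j)) : Inst k n m) i j = ((Φ i j).1, s i j) := rfl

end

end Summit.PneNP.PneNP.Cruxes.SearchHardWindow.DecoySketch
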